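import Literature.Computability.QuantumComplexity.PolyWindowReadout
import Literature.Computability.QuantumComplexity.PolyCopiesStatWindow
import HarnessLib

/-!
# `PromiseBQP` from a one-shot estimator carrying SEVERAL answer bits per run (window read-out + bounded-statistic window)

Topic `Literature/Computability/QuantumComplexity`; assembly of `PolyWindowReadout.lean` (the read-out `winThrF` counting
the ones in a window `[off, off + cnt)` of every block of the `K(n)`-copy family and comparing with an
instance-dependent rational threshold) and `PolyCopiesStatWindow.lean` (concentration of a bounded per-copy statistic;
mean of an event count = sum of the event probabilities). Result: Watrous's Prop. 3 (2009, §IV.2) for estimators whose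
one run yields a bounded COUNT rather than a bit — e.g. a block made of `m` juxtaposed sub-runs each writing one flag —
with a classical polynomial-time pre-processor `h` and thresholds read off the (pre-processed) instance.

* `count_take_drop_eq_sum` — `#ones((L.drop a).take c) = Σ_{i<c} [L.getD (a+i) = 1]` (positional form of a window count);
* `PolyCopies.winMean G offU cntU z` — the one-run mean of the window count:
  `Σ_{i<|cntU z|} G.kernelProb 0 z {s | s.getD (|offU z| + i) = 1}`;
* **`mem_PromiseBQP_of_window_thresholds_pre`** — if `G` (uniform, oracle-free) has window mean
  `≥ ⟦num(h v)⟧/⟦den(h v)⟧ + 1/(q(|h v|)+1)` on YES instances and `≤ … − 1/(q+1)` on NO instances (window inside the run's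
  own wires), then the promise problem is in `PromiseBQP` (`K(n) = 3·C(n)²·(q(n)+1)² + 1` copies, `C` a polynomial
  bound of the window width; error `≤ 1/12`).

Everything here is PROVED; one definition (`winMean`, an abbreviation of a real number).

## References

* J. Watrous, *Quantum computational complexity*, Springer Encyclopedia 2009 (arXiv:0804.3401), §IV.2 Prop. 3
  [Watrous2009].
* S. Arora, B. Barak, *Computational Complexity: A Modern Approach*, CUP 2009, Appendix A Lemma A.12; §1.3 [AroraBarak2009].
* E. Bernstein, U. Vazirani, *Quantum complexity theory*, SIAM J. Comput. 26 (1997), §8 (classical pre/post-processing)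
  [BernsteinVazirani1997].
-/

noncomputable section

namespace Literature.Computability.QuantumComplexity

open _root_.Computability Complexity Complexity.Brick Cryptography Finset

/-! ### Window counts, positionally -/

/-- **A window count is a sum of positional indicators**: `#ones((L.drop a).take c) = Σ_{i<c} [L.getD (a+i) = 1]`.
[cite: AroraBarak2009, §1.3] -/
theorem count_take_drop_eq_sum : ∀ (L : List Bool) (a c : ℕ),
    (((L.drop a).take c).count true : ℕ) = ∑ i ∈ Finset.range c, if L.getD (a + i) false = true then 1 else 0
  | [], a, c => by simp
  | b :: L, a + 1, c => by
    rw [List.drop_succ_cons, count_take_drop_eq_sum L a c]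
    refine Finset.sum_congr rfl fun i _ => ?_
    rw [show a + 1 + i = (a + i) + 1 by omega, List.getD_cons_succ]
  | b :: L, 0, 0 => by simp
  | b :: L, 0, c + 1 => by
    have ih := count_take_drop_eq_sum L 0 c
    simp only [List.drop_zero, Nat.zero_add] at ih
    rw [List.drop_zero, List.take_succ_cons, List.count_cons, Finset.sum_range_succ', ih]
    simp

namespace PolyCopies

variable {P : Params}

/-- The window count of block `j` read off a measured register is the window count of the block's COPY STRING, provided
the window lies inside the copy's own wires. [cite: NielsenChuang2010, §2.2.8] -/
theorem winOnes_ofFn_eq_copy (x : List Bool) (z : QReg (x.length + anc P x.length)) (j : Fin (K P x.length))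
    {off cnt : ℕ} (hwin : off + cnt ≤ x.length + P.F.ancillas x.length) :
    winOnes (P := P) x.length off cnt (List.ofFn z) j =
      (((List.ofFn ((z ∘ blockEmb P x.length j) ∘ Fin.castLEEmb (copy_fits x.length))).drop off).take cnt).count true := by
  rw [winOnes_ofFn, count_take_drop_eq_sum, count_take_drop_eq_sum]
  refine Finset.sum_congr rfl fun i hi => ?_
  have hi' : i < cnt := Finset.mem_range.1 hi
  have h1 : off + i < x.length + P.F.ancillas x.length := by omega
  have h2 : blk P x.length j 0 + off + i < x.length + anc P x.length := by
    have := blk_fits (P := P) (n := x.length) (j := j) j.isLt (i := off + i) (by have := copy_fits (P := P) x.length; omega)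
    rw [blk_eq_add] at this
    simpa [Nat.add_assoc] using this
  have e1 : (List.ofFn z).getD (blk P x.length j 0 + off + i) false = z ⟨blk P x.length j 0 + off + i, h2⟩ := by
    rw [List.getD_eq_getElem?_getD, List.getElem?_ofFn, dif_pos h2, Option.getD_some]
  have e2 : (List.ofFn ((z ∘ blockEmb P x.length j) ∘ Fin.castLEEmb (copy_fits x.length))).getD (off + i) false =
      z ⟨blk P x.length j 0 + off + i, h2⟩ := by
    rw [List.getD_eq_getElem?_getD, List.getElem?_ofFn, dif_pos h1, Option.getD_some]
    simp only [Function.comp_apply, Fin.castLEEmb_apply]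
    congr 1
    apply Fin.ext
    simp [blockEmb, blk_eq_add (P := P) x.length j (off + i), Nat.add_assoc]
  rw [e1, e2]

/-- **The one-run mean of the window count**: the sum over the window positions of the probabilities that the run's
output bit there reads `1`. [cite: NielsenChuang2010, §2.2.8] [cite: AroraBarak2009, Appendix A (linearity of expectation)] -/
def winMean (G : QCircuitFamily cliffordT) (offU cntU : List Bool → List Bool) (z : List Bool) : ℝ :=
  ∑ i ∈ Finset.range (cntU z).length, G.kernelProb 0 z {s | s.getD ((offU z).length + i) false = true}

end PolyCopies

/-! ### The `PromiseBQP` statement -/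

open PolyCopies in
/-- **`PromiseBQP` from a one-shot estimator with several answer bits per run (window read-out).** Let `h ∈ FP`
pre-process the instance, `G` be a uniform oracle-free Clifford+T family whose runs on `z = h v` carry answer bits in the
window `[|offU z|, |offU z| + |cntU z|)` of their own wires (`offU, cntU ∈ FP`), and let the WINDOW MEAN
`winMean G offU cntU (h v)` (the expected number of ones in the window) be `≥ ⟦num(h v)⟧/⟦den(h v)⟧ + 1/(q(|h v|)+1)` on
YES instances and `≤ ⟦num(h v)⟧/⟦den(h v)⟧ − 1/(q(|h v|)+1)` on NO instances (`num, den ∈ FP`, `⟦den⟧ > 0` on the promise,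
`q` a polynomial). Then the promise problem is in `PromiseBQP`: polynomially many parallel copies of `G` on `h v`, the
window read-out `winThrF`, error `≤ 1/12` by the bounded-statistic window. [cite: Watrous2009, §IV.2 Prop. 3]
[cite: BernsteinVazirani1997, §8] -/
theorem mem_PromiseBQP_of_window_thresholds_pre (Q : PromiseProblem) {h : List Bool → List Bool} (hh : h ∈ FP)
    {G : QCircuitFamily cliffordT} (hG : G.IsOracleFree) (hU : G.IsUniform)
    {offU cntU num den : List Bool → List Bool} (hoff : offU ∈ FP) (hcnt : cntU ∈ FP) (hnum : num ∈ FP)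
    (hden : den ∈ FP) (q : Polynomial ℕ)
    (hwin : ∀ z, (offU z).length + (cntU z).length ≤ z.length + G.ancillas z.length)
    (hdenY : ∀ v ∈ Q.yes, 0 < bitsToNat (den (h v))) (hdenN : ∀ v ∈ Q.no, 0 < bitsToNat (den (h v)))
    (hyes : ∀ v ∈ Q.yes,
      (bitsToNat (num (h v)) : ℝ) / bitsToNat (den (h v)) + 1 / (((q.eval (h v).length : ℕ) : ℝ) + 1) ≤
        winMean G offU cntU (h v))
    (hno : ∀ v ∈ Q.no,
      winMean G offU cntU (h v) ≤
        (bitsToNat (num (h v)) : ℝ) / bitsToNat (den (h v)) - 1 / (((q.eval (h v).length : ℕ) : ℝ) + 1)) :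
    Q ∈ PromiseBQP := by
  classical
  obtain ⟨pF, hpF⟩ := QCircuitFamily.IsUniform.isPolySize' hU
  obtain ⟨C, hC⟩ := exists_poly_length_le_of_mem_FP hcnt
  let P₀ : PolyCopies.Params := ⟨G, pF, fun n => (hpF n).2, 3 * C ^ 2 * (q + 1) ^ 2⟩
  have hRfree : (PolyCopies.family P₀).IsOracleFree := PolyCopies.family_isOracleFree P₀ hG
  have hRU : (PolyCopies.family P₀).IsUniform := PolyCopies.family_isUniform P₀ hU
  have hg : (PolyCopies.winThrF P₀ offU cntU num den ∘ mapFstFn h) ∈ FP :=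
    comp_mem_FP (PolyCopies.winThrF_mem_FP (P := P₀) hoff hcnt hnum hden) (mapFstFn_mem_FP hh)
  obtain ⟨P, hPh, hPg, hPF⟩ := CWrap.exists_params hh hg hRU
  have hKeq : ∀ z : List Bool, (PolyCopies.K P₀ z.length : ℝ) =
      3 * ((C.eval z.length : ℕ) : ℝ) ^ 2 * (((q.eval z.length : ℕ) : ℝ) + 1) ^ 2 + 1 := by
    intro z
    show (((3 * C ^ 2 * (q + 1) ^ 2).eval z.length + 1 : ℕ) : ℝ) = _
    push_cast [Polynomial.eval_add, Polynomial.eval_mul, Polynomial.eval_pow, Polynomial.eval_ofNat, Polynomial.eval_one]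
    ring
  have hθ : ∀ z : List Bool, (0 : ℝ) < 1 / (((q.eval z.length : ℕ) : ℝ) + 1) := fun z => by positivity
  -- the per-copy statistic: number of ones in the window of the copy string
  let Z : ∀ z : List Bool, QReg (PolyCopies.b P₀ z.length) → ℝ := fun z v =>
    ((((List.ofFn (v ∘ Fin.castLEEmb (PolyCopies.copy_fits (P := P₀) z.length))).drop (offU z).length).take
      (cntU z).length).count true : ℝ)
  have hZ : ∀ (z : List Bool) (v : QReg (PolyCopies.b P₀ z.length)), 0 ≤ Z z v ∧ Z z v ≤ ((cntU z).length : ℝ) := by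
    intro z v
    refine ⟨by positivity, ?_⟩
    have h1 : (((List.ofFn (v ∘ Fin.castLEEmb (PolyCopies.copy_fits (P := P₀) z.length))).drop (offU z).length).take
        (cntU z).length).count true ≤ (cntU z).length :=
      List.count_le_length.trans (List.length_take_le _ _)
    simp only [Z]
    exact_mod_cast h1
  -- its mean is the window mean
  have hmean : ∀ z : List Bool,
      (∑ v, ‖PolyCopies.blockState P₀ z v‖ ^ 2 * Z z v) = winMean G offU cntU z := by
    intro z
    have e : ∀ v : QReg (PolyCopies.b P₀ z.length), Z z v =
        (((Finset.range (cntU z).length).filter fun i =>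
          List.ofFn (v ∘ Fin.castLEEmb (PolyCopies.copy_fits (P := P₀) z.length)) ∈
            ({s : List Bool | s.getD ((offU z).length + i) false = true} : Set (List Bool))).card : ℝ) := by
      intro v
      simp only [Z]
      rw [count_take_drop_eq_sum]
      push_cast
      rw [Finset.card_filter]
      push_cast
      refine Finset.sum_congr rfl fun i _ => ?_
      simp only [Set.mem_setOf_eq]
    simp_rw [e]
    rw [PolyCopies.sum_normSq_blockState_mul_eventCount (P := P₀) z (cntU z).length
      (fun i => ({s : List Bool | s.getD ((offU z).length + i) false = true} : Set (List Bool)))]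
    rfl
  -- error bound: cnt² (q+1)² / (4K) ≤ 1/12
  have hbound : ∀ z : List Bool,
      ((cntU z).length : ℝ) ^ 2 / (4 * PolyCopies.K P₀ z.length * (1 / (((q.eval z.length : ℕ) : ℝ) + 1)) ^ 2) ≤ 1 / 12 := by
    intro z
    rw [hKeq z]
    have hq1 : (0 : ℝ) < ((q.eval z.length : ℕ) : ℝ) + 1 := by positivity
    have hc : ((cntU z).length : ℝ) ≤ ((C.eval z.length : ℕ) : ℝ) := by exact_mod_cast hC z
    have hc0 : (0 : ℝ) ≤ ((cntU z).length : ℝ) := Nat.cast_nonneg _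
    rw [div_le_div_iff₀ (by positivity) (by norm_num)]
    have hsq : ((cntU z).length : ℝ) ^ 2 ≤ ((C.eval z.length : ℕ) : ℝ) ^ 2 := pow_le_pow_left₀ hc0 hc 2
    have hpos : (0 : ℝ) ≤ (((q.eval z.length : ℕ) : ℝ) + 1) ^ 2 := sq_nonneg _
    field_simp
    nlinarith [mul_le_mul_of_nonneg_right hsq hpos]
  -- the count over the blocks is the read-out's `winCount`
  have hcount : ∀ (z : List Bool) (z' : QReg (z.length + PolyCopies.anc P₀ z.length)),
      (∑ j : Fin (PolyCopies.K P₀ z.length), Z z (z' ∘ PolyCopies.blockEmb P₀ z.length j)) =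
        (PolyCopies.winCount (P := P₀) (offU := offU) (cntU := cntU) z (List.ofFn z') : ℝ) := by
    intro z z'
    simp only [Z, PolyCopies.winCount]
    push_cast
    rw [← Fin.sum_univ_eq_sum_range]
    refine Finset.sum_congr rfl fun j _ => ?_
    rw [PolyCopies.winOnes_ofFn_eq_copy (P := P₀) z z' j (hwin z)]
    rfl
  have hgval : ∀ v y : List Bool, (PolyCopies.winThrF P₀ offU cntU num den ∘ mapFstFn h) (boolPair v y) =
      PolyCopies.winThrF P₀ offU cntU num den (boolPair (h v) y) := by
    intro v y
    rw [Function.comp_apply, mapFstFn_boolPair]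
  refine ⟨CWrap.family P, CWrap.family_isOracleFree P (hPF ▸ hRfree), CWrap.family_isUniform P (hPF ▸ hRU),
    fun v hv => ?_, fun v hv => ?_⟩
  · -- YES: the window count is at least `t·K` with probability ≥ 11/12
    have hker := CWrap.kernelProb_family_ge P v
      (fun z => {y | PolyCopies.winThrF P₀ offU cntU num den (boolPair z y) = [true]})
    rw [hPh, hPg, hPF] at hker
    have hsub : {z' | ∃ y ∈ ({y | PolyCopies.winThrF P₀ offU cntU num den (boolPair (h v) y) = [true]} : Set (List Bool)),
        (PolyCopies.winThrF P₀ offU cntU num den ∘ mapFstFn h) (boolPair v y) <+: z'} ⊆ {z' | [true] <+: z'} := by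
      rintro z' ⟨y, hy, hz⟩
      rw [Set.mem_setOf_eq] at hy
      rw [hgval, hy] at hz
      exact hz
    rw [← kernelProb_prefix_true_eq_acceptProbOn]
    have hd : (0 : ℝ) < bitsToNat (den (h v)) := by exact_mod_cast hdenY v hv
    have h1 := PolyCopies.kernelProb_ge_of_stat_window (P := P₀) (h v) (Z (h v)) (hZ (h v)) (hθ (h v))
      {y | PolyCopies.winThrF P₀ offU cntU num den (boolPair (h v) y) = [true]} fun z' hz' => by
        rw [Set.mem_setOf_eq, PolyCopies.winThrF_boolPair]
        simp only [List.cons.injEq, and_true, decide_eq_true_eq]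
        rw [hmean (h v), hcount (h v) z'] at hz'
        have hlow := (abs_lt.mp hz').1
        have hK0 : (0 : ℝ) ≤ (PolyCopies.K P₀ (h v).length : ℝ) := Nat.cast_nonneg _
        have h2 := mul_le_mul_of_nonneg_right (hyes v hv) hK0
        rw [add_mul] at h2
        have hW : (bitsToNat (num (h v)) : ℝ) / bitsToNat (den (h v)) * (PolyCopies.K P₀ (h v).length : ℝ) <
            (PolyCopies.winCount (P := P₀) (offU := offU) (cntU := cntU) (h v) (List.ofFn z') : ℝ) := by
          linarith
        rw [div_mul_eq_mul_div, div_lt_iff₀ hd] at hW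
        have h3 : (bitsToNat (num (h v)) : ℝ) * (PolyCopies.K P₀ (h v).length : ℝ) ≤
            (bitsToNat (den (h v)) : ℝ) *
              (PolyCopies.winCount (P := P₀) (offU := offU) (cntU := cntU) (h v) (List.ofFn z') : ℝ) := by
          linarith
        exact_mod_cast h3
    have h1' : (11 : ℝ) / 12 ≤ (PolyCopies.family P₀).kernelProb 0 (h v)
        {y | PolyCopies.winThrF P₀ offU cntU num den (boolPair (h v) y) = [true]} := by
      linarith [h1, hbound (h v)]
    linarith [(h1'.trans hker).trans ((CWrap.family P).kernelProb_mono 0 v hsub)]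
  · -- NO: the window count is below `t·K` with probability ≥ 11/12
    have hker := CWrap.kernelProb_family_ge P v
      (fun z => {y | PolyCopies.winThrF P₀ offU cntU num den (boolPair z y) = [false]})
    rw [hPh, hPg, hPF] at hker
    have hsub : {z' | ∃ y ∈ ({y | PolyCopies.winThrF P₀ offU cntU num den (boolPair (h v) y) = [false]} : Set (List Bool)),
        (PolyCopies.winThrF P₀ offU cntU num den ∘ mapFstFn h) (boolPair v y) <+: z'} ⊆ {z' | [false] <+: z'} := by
      rintro z' ⟨y, hy, hz⟩
      rw [Set.mem_setOf_eq] at hy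
      rw [hgval, hy] at hz
      exact hz
    have hd : (0 : ℝ) < bitsToNat (den (h v)) := by exact_mod_cast hdenN v hv
    have h1 := PolyCopies.kernelProb_ge_of_stat_window (P := P₀) (h v) (Z (h v)) (hZ (h v)) (hθ (h v))
      {y | PolyCopies.winThrF P₀ offU cntU num den (boolPair (h v) y) = [false]} fun z' hz' => by
        rw [Set.mem_setOf_eq, PolyCopies.winThrF_boolPair]
        simp only [List.cons.injEq, and_true, decide_eq_false_iff_not, not_le]
        rw [hmean (h v), hcount (h v) z'] at hz'
        have hup := (abs_lt.mp hz').2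
        have hK0 : (0 : ℝ) ≤ (PolyCopies.K P₀ (h v).length : ℝ) := Nat.cast_nonneg _
        have h2 := mul_le_mul_of_nonneg_right (hno v hv) hK0
        rw [sub_mul] at h2
        have hW : (PolyCopies.winCount (P := P₀) (offU := offU) (cntU := cntU) (h v) (List.ofFn z') : ℝ) <
            (bitsToNat (num (h v)) : ℝ) / bitsToNat (den (h v)) * (PolyCopies.K P₀ (h v).length : ℝ) := by
          linarith
        rw [div_mul_eq_mul_div, lt_div_iff₀ hd] at hW
        have h3 : (bitsToNat (den (h v)) : ℝ) *
              (PolyCopies.winCount (P := P₀) (offU := offU) (cntU := cntU) (h v) (List.ofFn z') : ℝ) <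
            (bitsToNat (num (h v)) : ℝ) * (PolyCopies.K P₀ (h v).length : ℝ) := by
          linarith
        exact_mod_cast h3
    have h1' : (11 : ℝ) / 12 ≤ (PolyCopies.family P₀).kernelProb 0 (h v)
        {y | PolyCopies.winThrF P₀ offU cntU num den (boolPair (h v) y) = [false]} := by
      linarith [h1, hbound (h v)]
    have h2 := (h1'.trans hker).trans ((CWrap.family P).kernelProb_mono 0 v hsub)
    have h3 := kernelProb_add_kernelProb_le_one (CWrap.family P) 0 v disjoint_prefix_true_false
    rw [kernelProb_prefix_true_eq_acceptProbOn] at h3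
    linarith

end Literature.Computability.QuantumComplexity

end
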